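import Literature.Combinatorics.SetFamily.FranklWilsonTheorem
import HarnessLib

/-!
# Two-distance sets in `ℝⁿ` have at most `C(n,2) + 3n + 2` points (Larman–Rogers–Seidel 1977)

S. Jukna, *Extremal Combinatorics — with applications in computer science* (1st ed., Springer 2001)
[Jukna2001], Chapter 14 "The basic method", §14.3 "Spaces of polynomials", §14.3.1 "Two-distance
sets": Theorem 14.12 (Larman–Rogers–Seidel 1977) with the proof printed there (the
polynomial method: Lemma 14.11 = the tree's
`Literature.Combinatorics.SetFamily.linearIndependent_of_triangular_eval`); original:
D. G. Larman, C. A. Rogers, J. J. Seidel, *On two-distance sets in Euclidean space*, Bull. London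
Math. Soc. 9 (1977) 261–267 [LarmanRogersSeidel1977].

**Theorem 14.12.** Every two-distance set in `ℝⁿ` (a set of points whose pairwise distances take
only two values) has at most `C(n,2) + 3n + 2` points.

Printed proof: with the two distances `d₁, d₂` (both nonzero) associate with each point `a_i` the
polynomial `f_i(x) = (‖x − a_i‖² − d₁²)(‖x − a_i‖² − d₂²)`; then `f_i(a_i) = (d₁d₂)² ≠ 0` and
`f_i(a_j) = 0` (`j ≠ i`), so the `f_i` are linearly independent (Lemma 14.11), and each is a linear
combination of `(Σ_l x_l²)²`, `(Σ_l x_l²) x_j`, `x_i x_j`, `x_j`, `1` — `1 + n + (C(n,2) + n) + n + 1`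
functions.

PROVED here (theorems only, no named facts), for finite subsets of `EuclideanSpace ℝ ι`
(`n = |ι|`), with the squared distance written in coordinates `‖x − a‖² = Σ_l (x_l − a_l)²`
(`dist_sq_eq_sum_sub_sq`):
* `lrsFun_mem` — the expansion: `f_a` lies in any subspace containing the five kinds of functions;
* **`two_distance_card_le`** — Theorem 14.12 for two admissible nonzero distances `d₁, d₂`
  (`dist x y ∈ {d₁, d₂}` for distinct `x, y ∈ S`); the monomials `x_i x_j` are indexed by `Sym2 ι`
  (`|Sym2 ι| = C(n+1, 2)`), and the count is Mathlib's `linearIndependent_le_span_aux'`;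
* **`two_distance_card_le_of_card_image_dist_le_two`** — the form "the pairwise distances between
  distinct points take at most two values";
* **`two_distance_card_le_of_finrank`** — the coordinate-free form in a finite-dimensional real
  inner product space of dimension `n` (transport by `stdOrthonormalBasis`).

Not treated: Blokhuis's improvement to `C(n+2, 2)` and the `s`-distance bound `C(n+s+1, s)`
(Exercise 14.19).

## References

* [Jukna2001] S. Jukna, *Extremal Combinatorics*, 1st ed., Springer (2001), Theorem 14.12 and its
  proof (held text `book:jukna2011-extremal-combinatorics-with-applications-computer-science`,
  chunks 176–177).
* [LarmanRogersSeidel1977] D. G. Larman, C. A. Rogers, J. J. Seidel, Bull. London Math. Soc. 9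
  (1977) 261–267.
-/

namespace Literature.Geometry.DiscreteGeometry

open Finset

section Coordinates

variable {ι : Type*} [Fintype ι]

/-- `dist(x, y)² = Σ_l (x_l − y_l)²` in `EuclideanSpace ℝ ι`. [cite: Jukna2001, Ch. 14 §14.3.1,
proof of Theorem 14.12 ("`‖x‖ = (Σ x_i²)^{1/2}` … the distance between `x, y` is `‖x − y‖`")] -/
theorem dist_sq_eq_sum_sub_sq (x y : EuclideanSpace ℝ ι) : dist x y ^ 2 = ∑ l, (x l - y l) ^ 2 := by
  rw [EuclideanSpace.dist_sq_eq]
  refine Finset.sum_congr rfl fun l _ => ?_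
  rw [Real.dist_eq, sq_abs]

/-- **The expansion step of the printed proof.** The polynomial
`f_a(x) = (‖x − a‖² − d₁²)(‖x − a‖² − d₂²)` is a linear combination of the functions `(Σ_l x_l²)²`,
`(Σ_l x_l²) x_j`, `x_i x_j`, `x_j` and `1`: it lies in every subspace `W` of functions containing
them. [cite: Jukna2001, Ch. 14 §14.3.1, proof of Theorem 14.12 ("every such polynomial is an
appropriate linear combination of the following polynomials")] -/
theorem lrsFun_mem {W : Submodule ℝ (EuclideanSpace ℝ ι → ℝ)}
    (hN2 : (fun x : EuclideanSpace ℝ ι => (∑ l, x l ^ 2) ^ 2) ∈ W)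
    (hNx : ∀ j, (fun x : EuclideanSpace ℝ ι => (∑ l, x l ^ 2) * x j) ∈ W)
    (hxx : ∀ i j, (fun x : EuclideanSpace ℝ ι => x i * x j) ∈ W)
    (hx : ∀ j, (fun x : EuclideanSpace ℝ ι => x j) ∈ W)
    (h1 : (fun _ : EuclideanSpace ℝ ι => (1 : ℝ)) ∈ W)
    (a : EuclideanSpace ℝ ι) (d₁ d₂ : ℝ) :
    (fun x : EuclideanSpace ℝ ι =>
      ((∑ l, (x l - a l) ^ 2) - d₁ ^ 2) * ((∑ l, (x l - a l) ^ 2) - d₂ ^ 2)) ∈ W := by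
  have key : (fun x : EuclideanSpace ℝ ι =>
        ((∑ l, (x l - a l) ^ 2) - d₁ ^ 2) * ((∑ l, (x l - a l) ^ 2) - d₂ ^ 2)) =
      (fun x : EuclideanSpace ℝ ι => (∑ l, x l ^ 2) ^ 2)
        - (4 : ℝ) • (∑ j, a j • (fun x : EuclideanSpace ℝ ι => (∑ l, x l ^ 2) * x j))
        + (4 : ℝ) • (∑ i, ∑ j, (a i * a j) • (fun x : EuclideanSpace ℝ ι => x i * x j))
        + (((∑ l, a l ^ 2) - d₁ ^ 2) + ((∑ l, a l ^ 2) - d₂ ^ 2)) •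
            (∑ j, (fun x : EuclideanSpace ℝ ι => x j * x j))
        - (2 * (((∑ l, a l ^ 2) - d₁ ^ 2) + ((∑ l, a l ^ 2) - d₂ ^ 2))) •
            (∑ j, a j • (fun x : EuclideanSpace ℝ ι => x j))
        + (((∑ l, a l ^ 2) - d₁ ^ 2) * ((∑ l, a l ^ 2) - d₂ ^ 2)) •
            (fun _ : EuclideanSpace ℝ ι => (1 : ℝ)) := by
    funext x
    simp only [Pi.add_apply, Pi.sub_apply, Pi.smul_apply, Finset.sum_apply, smul_eq_mul]
    have hq : ∑ l, (x l - a l) ^ 2 = (∑ l, x l ^ 2) - 2 * (∑ l, a l * x l) + ∑ l, a l ^ 2 := by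
      simp only [sub_sq]
      rw [Finset.sum_add_distrib, Finset.sum_sub_distrib, Finset.mul_sum]
      congr 2
      exact Finset.sum_congr rfl fun l _ => by ring
    have h1 : ∑ j, a j * ((∑ l, x l ^ 2) * x j) = (∑ l, x l ^ 2) * ∑ l, a l * x l := by
      rw [Finset.mul_sum]
      exact Finset.sum_congr rfl fun l _ => by ring
    have h2 : ∑ i, ∑ j, a i * a j * (x i * x j) = (∑ l, a l * x l) ^ 2 := by
      rw [sq, Finset.sum_mul_sum]
      exact Finset.sum_congr rfl fun i _ => Finset.sum_congr rfl fun j _ => by ring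
    have h3 : ∑ j, x j * x j = ∑ l, x l ^ 2 := Finset.sum_congr rfl fun l _ => by ring
    rw [hq, h1, h2, h3, mul_one]
    ring
  rw [key]
  refine W.add_mem (W.sub_mem (W.add_mem (W.add_mem (W.sub_mem hN2 ?_) ?_) ?_) ?_) ?_
  · exact W.smul_mem _ (W.sum_mem fun j _ => W.smul_mem _ (hNx j))
  · exact W.smul_mem _ (W.sum_mem fun i _ => W.sum_mem fun j _ => W.smul_mem _ (hxx i j))
  · exact W.smul_mem _ (W.sum_mem fun j _ => hxx j j)
  · exact W.smul_mem _ (W.sum_mem fun j _ => W.smul_mem _ (hx j))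
  · exact W.smul_mem _ h1

/-- **Theorem 14.12 (Larman–Rogers–Seidel 1977).** If the distances between distinct points of a
finite set `S ⊆ ℝⁿ` take only the two nonzero values `d₁, d₂`, then
`|S| ≤ C(n,2) + 3n + 2`. [cite: Jukna2001, Ch. 14 §14.3.1, Theorem 14.12;
LarmanRogersSeidel1977] -/
theorem two_distance_card_le (S : Finset (EuclideanSpace ℝ ι)) {d₁ d₂ : ℝ} (hd₁ : d₁ ≠ 0)
    (hd₂ : d₂ ≠ 0) (hS : ∀ x ∈ S, ∀ y ∈ S, x ≠ y → dist x y = d₁ ∨ dist x y = d₂) :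
    S.card ≤ (Fintype.card ι).choose 2 + 3 * Fintype.card ι + 2 := by
  classical
  -- the polynomials `f_a`
  set f : S → (EuclideanSpace ℝ ι → ℝ) := fun a x =>
    ((∑ l, (x l - (a : EuclideanSpace ℝ ι) l) ^ 2) - d₁ ^ 2) *
      ((∑ l, (x l - (a : EuclideanSpace ℝ ι) l) ^ 2) - d₂ ^ 2) with hf
  -- Lemma 14.11: they are linearly independent
  have hli : LinearIndependent ℝ f := by
    refine Literature.Combinatorics.SetFamily.linearIndependent_of_triangular_eval f
      (fun a => (a : EuclideanSpace ℝ ι)) (fun _ => 0) (fun a => ?_) (fun a b hab _ => ?_)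
    · simp [hf, hd₁, hd₂]
    · simp only [hf]
      rw [← dist_sq_eq_sum_sub_sq]
      have hab' : (a : EuclideanSpace ℝ ι) ≠ (b : EuclideanSpace ℝ ι) :=
        fun h => hab (Subtype.ext h)
      rcases hS _ a.2 _ b.2 hab' with h | h
      · rw [h, sub_self, zero_mul]
      · rw [h, sub_self, mul_zero]
  -- the spanning family: `(Σx²)²`, `(Σx²)x_j`, `x_i x_j` (indexed by `Sym2 ι`), `x_j`, `1`
  let g : Unit ⊕ ι ⊕ Sym2 ι ⊕ ι ⊕ Unit → (EuclideanSpace ℝ ι → ℝ) :=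
    Sum.elim (fun _ x => (∑ l, x l ^ 2) ^ 2)
      (Sum.elim (fun j x => (∑ l, x l ^ 2) * x j)
        (Sum.elim (fun p x => Sym2.lift ⟨fun i j => x i * x j, fun i j => mul_comm _ _⟩ p)
          (Sum.elim (fun j x => x j) (fun _ _ => 1))))
  have hN2 : (fun x : EuclideanSpace ℝ ι => (∑ l, x l ^ 2) ^ 2) ∈
      Submodule.span ℝ (Set.range g) :=
    Submodule.subset_span ⟨Sum.inl (), rfl⟩
  have hNx : ∀ j, (fun x : EuclideanSpace ℝ ι => (∑ l, x l ^ 2) * x j) ∈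
      Submodule.span ℝ (Set.range g) := fun j =>
    Submodule.subset_span ⟨Sum.inr (Sum.inl j), rfl⟩
  have hxx : ∀ i j, (fun x : EuclideanSpace ℝ ι => x i * x j) ∈
      Submodule.span ℝ (Set.range g) := fun i j =>
    Submodule.subset_span ⟨Sum.inr (Sum.inr (Sum.inl s(i, j))), by funext x; simp [g]⟩
  have hx : ∀ j, (fun x : EuclideanSpace ℝ ι => x j) ∈ Submodule.span ℝ (Set.range g) := fun j =>
    Submodule.subset_span ⟨Sum.inr (Sum.inr (Sum.inr (Sum.inl j))), rfl⟩
  have h1 : (fun _ : EuclideanSpace ℝ ι => (1 : ℝ)) ∈ Submodule.span ℝ (Set.range g) :=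
    Submodule.subset_span ⟨Sum.inr (Sum.inr (Sum.inr (Sum.inr ()))), rfl⟩
  have hspan : Set.range f ≤ Submodule.span ℝ (Set.range g) := by
    rintro _ ⟨a, rfl⟩
    exact lrsFun_mem hN2 hNx hxx hx h1 _ d₁ d₂
  -- the linear algebra bound and the count
  have hcard := linearIndependent_le_span_aux' f hli (Set.range g) hspan
  rw [Fintype.card_coe] at hcard
  refine hcard.trans ((Fintype.card_range_le g).trans ?_)
  have hsym : (Fintype.card ι + 1).choose 2 = Fintype.card ι + (Fintype.card ι).choose 2 := by
    simpa using Nat.choose_succ_succ' (Fintype.card ι) 1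
  simp only [Fintype.card_sum, Fintype.card_unit, Sym2.card, hsym]
  omega

/-- **Theorem 14.12, "two-distance set" form.** If the pairwise distances between distinct points
of a finite set `S ⊆ ℝⁿ` take at most two values, then `|S| ≤ C(n,2) + 3n + 2`.
[cite: Jukna2001, Ch. 14 §14.3.1, Theorem 14.12; LarmanRogersSeidel1977] -/
theorem two_distance_card_le_of_card_image_dist_le_two (S : Finset (EuclideanSpace ℝ ι))
    (hS : (S.offDiag.image fun p => dist p.1 p.2).card ≤ 2) :
    S.card ≤ (Fintype.card ι).choose 2 + 3 * Fintype.card ι + 2 := by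
  classical
  set D := S.offDiag.image fun p => dist p.1 p.2 with hD
  -- all realised distances are nonzero
  have hpos : ∀ d ∈ D, d ≠ 0 := by
    intro d hd
    obtain ⟨p, hp, rfl⟩ := Finset.mem_image.mp hd
    exact dist_ne_zero.mpr (Finset.mem_offDiag.mp hp).2.2
  have hmem : ∀ x ∈ S, ∀ y ∈ S, x ≠ y → dist x y ∈ D := fun x hx y hy hxy =>
    Finset.mem_image.mpr ⟨(x, y), Finset.mem_offDiag.mpr ⟨hx, hy, hxy⟩, rfl⟩
  -- two nonzero values `d₁, d₂` covering `D`
  obtain ⟨d₁, d₂, hd₁, hd₂, hcover⟩ : ∃ d₁ d₂ : ℝ, d₁ ≠ 0 ∧ d₂ ≠ 0 ∧ ∀ d ∈ D, d = d₁ ∨ d = d₂ := by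
    obtain h | h | h : D.card = 0 ∨ D.card = 1 ∨ D.card = 2 := by omega
    · rw [Finset.card_eq_zero] at h
      exact ⟨1, 1, one_ne_zero, one_ne_zero, fun d hd => by simp [h] at hd⟩
    · obtain ⟨d, hd⟩ := Finset.card_eq_one.mp h
      refine ⟨d, d, hpos d (by simp [hd]), hpos d (by simp [hd]), fun d' hd' => ?_⟩
      rw [hd, Finset.mem_singleton] at hd'
      exact Or.inl hd'
    · obtain ⟨d, d', -, hdd'⟩ := Finset.card_eq_two.mp h
      refine ⟨d, d', hpos d (by simp [hdd']), hpos d' (by simp [hdd']), fun e he => ?_⟩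
      rw [hdd', Finset.mem_insert, Finset.mem_singleton] at he
      exact he
  exact two_distance_card_le S hd₁ hd₂ fun x hx y hy hxy => hcover _ (hmem x hx y hy hxy)

end Coordinates

/-- **Theorem 14.12, coordinate-free form.** In a real inner product space of dimension `n`, a
finite set whose distinct points are at distance `d₁` or `d₂` (both nonzero) from each other has at
most `C(n,2) + 3n + 2` points. [cite: Jukna2001, Ch. 14 §14.3.1, Theorem 14.12;
LarmanRogersSeidel1977] -/
theorem two_distance_card_le_of_finrank {V : Type*} [NormedAddCommGroup V]
    [InnerProductSpace ℝ V] [FiniteDimensional ℝ V] (S : Finset V) {d₁ d₂ : ℝ} (hd₁ : d₁ ≠ 0)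
    (hd₂ : d₂ ≠ 0) (hS : ∀ x ∈ S, ∀ y ∈ S, x ≠ y → dist x y = d₁ ∨ dist x y = d₂) :
    S.card ≤ (Module.finrank ℝ V).choose 2 + 3 * Module.finrank ℝ V + 2 := by
  classical
  set e := (stdOrthonormalBasis ℝ V).repr with he
  have h := two_distance_card_le (S.image e) hd₁ hd₂ (by
    intro x hx y hy hxy
    obtain ⟨x', hx', rfl⟩ := Finset.mem_image.mp hx
    obtain ⟨y', hy', rfl⟩ := Finset.mem_image.mp hy
    rw [e.dist_map]
    exact hS x' hx' y' hy' (fun h => hxy (h ▸ rfl)))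
  rwa [Finset.card_image_of_injective _ e.injective, Fintype.card_fin] at h

end Literature.Geometry.DiscreteGeometry
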